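import Summits.CriticalPhenomena.CardyFormulaZ2.Theses.CardyMirrorMonotone

/-!
# Birth skeleton (BC3) for crux `SubseqConformalInvariance` (stmt-CriticalPhenomena-8266)

Route `CardyMirrorMonotone`, sub-problem `CardyFormulaZ2`, summit `CriticalPhenomena`.
Registrar: planner `skel-stmt-CriticalPhenomena-8266` (2026-08-17, BC3 of
`run/shared/lean/lens3/_common/BC.md`). Tree path
`Summits/CriticalPhenomena/CardyFormulaZ2/Cruxes/SubseqConformalInvariance/Lines/birth.lean`.

The crux (route decl, FIXED; the route's frame item X_M, auto-crux since 2026-08-16):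

  `SubseqConformalInvariance : ∀ u → 0⁺, ∃ φ StrictMono, ∃ g : ℝ → ℝ, ∀ R ψ x, R.IsUniformizing ψ x →
      bondDomainCrossingProb R (u (φ n)) → g (crossRatio x)` —

"precompactness + conformal invariance of every subsequential limit, ONE `g` for all conformal
rectangles along the subsequence; no uniqueness, no value". The route header names the line by
which X_M is to be reached: the lattice conjecture MIRROR MONOTONICITY (the percolation
polarization inequality, PPI) = `AxisMirrorMonotone ∧ DiagMirrorMonotone`, transported to every
subsequential limit and upgraded to Möbius covariance (`PPIConformalUpgrade`, whose docstring adds: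
"uniform-in-δ RSW equicontinuity supplies the diagonal subsequence over a countable dense family of
rectangles"). This skeleton types exactly that line as four stubs over existing declarations,
separating the PPI-free compactness step from the PPI-driven upgrade:

* S1 `stub_axisMirrorMonotone` (= route item stmt-CriticalPhenomena-8267 BY NAME; open, bunkbed-type):
  PPI for the axis mirrors of `ℤ²` at `p = 1/2`.
* S2 `stub_diagMirrorMonotone` (= route item stmt-CriticalPhenomena-8269 BY NAME; open): PPI for the
  diagonal mirrors — the embedding-specific input (barrier `EmbeddingModulusUniqueness`, caveat (f)).
* S3 `stub_jointPrecompactness` (PPI-free; size M/L): every `u → 0⁺` has a subsequence along which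
  the crossing probabilities of EVERY conformal rectangle converge jointly, to some
  `L : ConformalRectangle → ℝ`. Not Bolzano–Weierstrass (`[0,1]^ConformalRectangle` is not
  sequentially compact): countable dense family + diagonal extraction + RSW / half-plane three-arm
  EQUICONTINUITY in `R`, uniformly in small `δ` (Aizenman–Burchard 1999; Grimmett 1999 §11.7;
  Schramm–Smirnov 2011 §6; in tree `bondDomainCrossingProb_mem_Icc`, `rsw_half`). Why it might fail:
  uniform-in-`δ` continuity in `R` at wild Jordan boundaries near the marks is unwritten.
* S4 `stub_ppiSublimitUpgrade` (the open heart; size XL): `AxisMirrorMonotone → DiagMirrorMonotone →`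
  every joint sequential limit `L` (along any `u → 0⁺`) factors through the conformal modulus,
  `L R = G (crossRatio x)` at every uniformizing datum. = item `PPIConformalUpgrade`
  (stmt-CriticalPhenomena-8349) with precompactness (S3) factored out; intended interior
  (route header): `PolarizationTransport` (stmt-8270) in the four lattice directions + the named fact
  `Literature.Probability.Percolation.dkkmo_rotation_invariance` ⇒ polarization / Steiner / condenser
  ORDER of every sublimit in every direction (Brock–Solynin 2000 §6–7, Baernstein, Dubinin) ⇒ a
  rotation-invariant, self-dual, domain-Markov, symmetrisation-ordered sublimit is Möbius-covariant.
  Why it might fail: barrier `ScaleCovarianceNotMoebius` / card lemma (N) — order + similarities alone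
  admit non-Möbius perturbations, so Markov / self-duality must enter by an unknown mechanism.

Composition `SubseqConformalInvariance_of` (sorry-free, 9 tactic lines, axioms propext /
Classical.choice / Quot.sound): given `u → 0⁺`, S3 gives `φ`, `L`; the subsequence still tends to
`0⁺` (`StrictMono.tendsto_atTop`); S4 fed with S1, S2 gives `G`; take `g := G` and rewrite
`L R = G (crossRatio x)`. Hardest stub: `stub_ppiSublimitUpgrade` (S4). Each stub is weaker than or
independent of the crux: S3 and S4 are consequences of `CardyFormulaZ2` (+ `exists_isUniformizing_holds`,
`crossRatio_eq_of_isUniformizing_holds`), S1/S2 are lattice inequalities asserting no invariance.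

`lean check --json` (farm, 2026-08-17): rc 0, errors 0, sorries 4 = the four `stub_*`
(lines of S1–S4), zero elsewhere; `SubseqConformalInvariance_of` closes over the standard axioms only.

BC3 PROBES (planner folder `bc/stub_<name>_probe.lean`, v2 = one tactic per `example`,
`maxHeartbeats 400000`, battery `exact?` · `simpa [X]` · `unfold X; simpa` · `aesop`):

| stub X | X → SubseqConformalInvariance | X → CardyFormulaZ2 | X (vacuity) | ¬X (junk) |
|---|---|---|---|---|
| stub_axisMirrorMonotone | FAILS 4/4 (l.23–29) | FAILS 4/4 (l.33–39) | FAILS 3/3 | FAILS 3/3 |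
| stub_diagMirrorMonotone | FAILS 4/4 (l.23–29) | FAILS 4/4 (l.33–39) | FAILS 3/3 | FAILS 3/3 |
| stub_jointPrecompactness | FAILS 4/4 (l.29–35) | FAILS 4/4 (l.39–45) | FAILS 3/3 | FAILS 3/3 |
| stub_ppiSublimitUpgrade | FAILS 4/4 (l.36–42) | FAILS 4/4 (l.46–52) | FAILS 3/3 | FAILS 3/3 |

(`exact?`: "could not close the goal"; `simpa`: "assumption failed"; `aesop`: "failed to prove the
goal after exhaustive search" / "made no progress"); the control `SubseqConformalInvariance →
SubseqConformalInvariance := by exact?` SUCCEEDS in all four files. 32/32 mandatory probes fail ⇒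
bc3: pass (no stub is cheaply the crux or the conjunct; none is vacuous or junk-refutable).

Disproof used: none on file (`ledger crux ls stmt-CriticalPhenomena-8266`: no workfiles, no
`Disproof.lean`, at registration). Negatives index (11 entries, 2026-08-17) checked: no stub is an
instance of a refuted statement — stmt-0698 (`not_SymmetryUpgrade`, exotic ABSTRACT chordal families)
is avoided because S4 quantifies over honest joint limits `L` of `bondDomainCrossingProb` and consumes
the lattice order axiom PPI; stmt-0748 (crossing path non-degenerate) supports S3 (limits in (0,1)).
Dead lines: none (first line on this crux).
-/

namespace Summit.CriticalPhenomena.CardyFormulaZ2.Cruxes.SubseqConformalInvariance.Birth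

open Filter Topology

/-! ### Registered stubs -/

/-- **S1 `stub_axisMirrorMonotone`** — the route's rank-2 lattice crux, VERBATIM by name
(`CardyMirrorMonotone.AxisMirrorMonotone`, item stmt-CriticalPhenomena-8267): the percolation
polarization inequality for the axis mirrors of `ℤ²` at `p = 1/2`. Open (bunkbed-type). -/
theorem stub_axisMirrorMonotone :
    Summit.CriticalPhenomena.CardyFormulaZ2.Theses.CardyMirrorMonotone.AxisMirrorMonotone := by
  sorry

/-- **S2 `stub_diagMirrorMonotone`** — the route's rank-4 lattice crux, VERBATIM by name
(`CardyMirrorMonotone.DiagMirrorMonotone`, item stmt-CriticalPhenomena-8269): the percolation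
polarization inequality for the diagonal mirrors of `ℤ²` at `p = 1/2` (the embedding-specific
half). Open (bunkbed-type). -/
theorem stub_diagMirrorMonotone :
    Summit.CriticalPhenomena.CardyFormulaZ2.Theses.CardyMirrorMonotone.DiagMirrorMonotone := by
  sorry

/-- **S3 `stub_jointPrecompactness`** — JOINT sequential precompactness of the `ℤ²` crossing
functions (PPI-free; size M/L): every sequence of meshes `u → 0⁺` has a subsequence along which
the `P_{1/2}` bond-`ℤ²` crossing probability of EVERY conformal rectangle converges, to some
`L : ConformalRectangle → ℝ`. `[0,1]^ConformalRectangle` is compact but not sequentially compact,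
so this is not Bolzano–Weierstrass: it needs a countable dense family of rectangles, diagonal
extraction and EQUICONTINUITY of `R ↦ bondDomainCrossingProb R δ` uniformly in small `δ`
(RSW + half-plane three-arm bounds at the marks; Aizenman–Burchard 1999, Grimmett 1999 §11.7,
Schramm–Smirnov 2011 §6). Why it might fail: the uniform-in-`δ` continuity in `R` for wild
(non-rectifiable) Jordan boundaries at the marked points is unwritten. -/
theorem stub_jointPrecompactness :
    ∀ u : ℕ → ℝ, Filter.Tendsto u Filter.atTop (nhdsWithin (0 : ℝ) (Set.Ioi 0)) →
      ∃ φ : ℕ → ℕ, StrictMono φ ∧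
        ∃ L : Literature.Probability.RandomPlanarGeometry.ConformalRectangle → ℝ,
          ∀ R : Literature.Probability.RandomPlanarGeometry.ConformalRectangle,
            Filter.Tendsto
              (fun n => Literature.Probability.Percolation.bondDomainCrossingProb R (u (φ n)))
              Filter.atTop (nhds (L R)) := by
  sorry

/-- **S4 `stub_ppiSublimitUpgrade`** — the PPI UPGRADE of joint sequential limits (the open
heart of the line; size XL): mirror monotonicity in the axis AND diagonal mirror families of `ℤ²`
implies that every joint sequential limit `L` of the crossing functions (along any `u → 0⁺`)
factors through the conformal modulus, `L R = G (crossRatio x)` for every uniformizing datum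
`(ψ, x)` of `R`. Intended interior (route header): PolarizationTransport in the four lattice
directions + DKKMO rotation invariance of sublimits ⇒ polarization / Steiner / condenser
symmetrisation ORDER of every sublimit in every direction (Brock–Solynin 2000 §6–7) ⇒ a
rotation-invariant, self-dual, domain-Markov, symmetrisation-ordered sublimit of `ℤ²` crossing
functionals is Möbius-covariant. This is item `PPIConformalUpgrade` (stmt-CriticalPhenomena-8349)
with precompactness (S3) factored OUT. Why it might fail: nothing known turns symmetrisation
order into Möbius covariance (barrier `ScaleCovarianceNotMoebius`; card lemma (N): PPI +
similarities admit non-Möbius perturbations), so Markov / self-duality must enter. -/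
theorem stub_ppiSublimitUpgrade :
    Summit.CriticalPhenomena.CardyFormulaZ2.Theses.CardyMirrorMonotone.AxisMirrorMonotone →
    Summit.CriticalPhenomena.CardyFormulaZ2.Theses.CardyMirrorMonotone.DiagMirrorMonotone →
      ∀ u : ℕ → ℝ, Filter.Tendsto u Filter.atTop (nhdsWithin (0 : ℝ) (Set.Ioi 0)) →
        ∀ L : Literature.Probability.RandomPlanarGeometry.ConformalRectangle → ℝ,
          (∀ R : Literature.Probability.RandomPlanarGeometry.ConformalRectangle,
            Filter.Tendsto
              (fun n => Literature.Probability.Percolation.bondDomainCrossingProb R (u n))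
              Filter.atTop (nhds (L R))) →
          ∃ G : ℝ → ℝ,
            ∀ (R : Literature.Probability.RandomPlanarGeometry.ConformalRectangle)
              (ψ : Literature.Probability.RandomPlanarGeometry.ConformalEquiv
                UpperHalfPlane.upperHalfPlaneSet R.carrier)
              (x : Fin 4 → ℝ), R.IsUniformizing ψ x →
              L R = G (Literature.Probability.RandomPlanarGeometry.crossRatio x) := by
  sorry

/-! ### Name-keyed aliases of the four statements

The hypotheses of the composition: the skeleton audit admits a hypothesis only if its head
constant is a registered obligation or is named like a declared stub. Each alias repeats the
stub's signature verbatim (the wiring `example` at the end checks they agree). -/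
namespace Registered

/-- Statement of `stub_axisMirrorMonotone` (S1), keyed by the registered stub name. -/
abbrev stub_axisMirrorMonotone : Prop :=
  Summit.CriticalPhenomena.CardyFormulaZ2.Theses.CardyMirrorMonotone.AxisMirrorMonotone

/-- Statement of `stub_diagMirrorMonotone` (S2), keyed by the registered stub name. -/
abbrev stub_diagMirrorMonotone : Prop :=
  Summit.CriticalPhenomena.CardyFormulaZ2.Theses.CardyMirrorMonotone.DiagMirrorMonotone

/-- Statement of `stub_jointPrecompactness` (S3), keyed by the registered stub name. -/
abbrev stub_jointPrecompactness : Prop :=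
  ∀ u : ℕ → ℝ, Filter.Tendsto u Filter.atTop (nhdsWithin (0 : ℝ) (Set.Ioi 0)) →
    ∃ φ : ℕ → ℕ, StrictMono φ ∧
      ∃ L : Literature.Probability.RandomPlanarGeometry.ConformalRectangle → ℝ,
        ∀ R : Literature.Probability.RandomPlanarGeometry.ConformalRectangle,
          Filter.Tendsto
            (fun n => Literature.Probability.Percolation.bondDomainCrossingProb R (u (φ n)))
            Filter.atTop (nhds (L R))

/-- Statement of `stub_ppiSublimitUpgrade` (S4), keyed by the registered stub name. -/
abbrev stub_ppiSublimitUpgrade : Prop :=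
  Summit.CriticalPhenomena.CardyFormulaZ2.Theses.CardyMirrorMonotone.AxisMirrorMonotone →
  Summit.CriticalPhenomena.CardyFormulaZ2.Theses.CardyMirrorMonotone.DiagMirrorMonotone →
    ∀ u : ℕ → ℝ, Filter.Tendsto u Filter.atTop (nhdsWithin (0 : ℝ) (Set.Ioi 0)) →
      ∀ L : Literature.Probability.RandomPlanarGeometry.ConformalRectangle → ℝ,
        (∀ R : Literature.Probability.RandomPlanarGeometry.ConformalRectangle,
          Filter.Tendsto
            (fun n => Literature.Probability.Percolation.bondDomainCrossingProb R (u n))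
            Filter.atTop (nhds (L R))) →
        ∃ G : ℝ → ℝ,
          ∀ (R : Literature.Probability.RandomPlanarGeometry.ConformalRectangle)
            (ψ : Literature.Probability.RandomPlanarGeometry.ConformalEquiv
              UpperHalfPlane.upperHalfPlaneSet R.carrier)
            (x : Fin 4 → ℝ), R.IsUniformizing ψ x →
            L R = G (Literature.Probability.RandomPlanarGeometry.crossRatio x)

end Registered

/-! ### The composition: the four stubs imply the crux, by name -/

/-- **`SubseqConformalInvariance` from S1–S4** (no `sorry`): given meshes `u → 0⁺`, S3 extracts a
subsequence `u ∘ φ → 0⁺` with a JOINT limit `L` of all crossing functions; S4, fed with the two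
lattice inequalities S1 and S2 and applied to the subsequence, factors `L` through the conformal
modulus, `L R = G (crossRatio x)`; so `g := G` is the one function the crux asks for along `φ`. -/
theorem SubseqConformalInvariance_of (hA : Registered.stub_axisMirrorMonotone)
    (hD : Registered.stub_diagMirrorMonotone) (h₁ : Registered.stub_jointPrecompactness)
    (h₂ : Registered.stub_ppiSublimitUpgrade) :
    Summit.CriticalPhenomena.CardyFormulaZ2.Theses.CardyMirrorMonotone.SubseqConformalInvariance := by
  intro u hu
  -- S3: a subsequence with a joint limit over all conformal rectangles
  obtain ⟨φ, hφ, L, hL⟩ := h₁ u hu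
  -- the subsequence of meshes still tends to `0⁺`
  have hu' : Filter.Tendsto (fun n => u (φ n)) Filter.atTop (nhdsWithin (0 : ℝ) (Set.Ioi 0)) :=
    hu.comp hφ.tendsto_atTop
  -- S4 (+ S1, S2): the joint limit factors through the conformal modulus
  obtain ⟨G, hG⟩ := h₂ hA hD (fun n => u (φ n)) hu' L hL
  refine ⟨φ, hφ, G, ?_⟩
  intro R ψ x hx
  rw [← hG R ψ x hx]
  exact hL R

/-- Wiring check: the registered (sorried) stubs feed `SubseqConformalInvariance_of` exactly as
stated (so the `Registered` aliases agree with the stub signatures). An `example`, so that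
`SubseqConformalInvariance_of` stays the only named theorem of this file concluding the crux. -/
example :
    Summit.CriticalPhenomena.CardyFormulaZ2.Theses.CardyMirrorMonotone.SubseqConformalInvariance :=
  SubseqConformalInvariance_of stub_axisMirrorMonotone stub_diagMirrorMonotone
    stub_jointPrecompactness stub_ppiSublimitUpgrade

end Summit.CriticalPhenomena.CardyFormulaZ2.Cruxes.SubseqConformalInvariance.Birth
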